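import Mathlib

/-!
# Ideator-1 PROVED LEMMAS for crux `CoercivePulse.LinearCeiling` (stmt-AtomisticToContinuum-15383) — NOT A SKELETON

This file is published under `Lines/` only because it is the one `.lean` slot of the crux workfiles; it
registers no stubs and concludes nothing about the crux by name. It carries the sorry-free real-analysis /
measure-theory lemmas behind two crux ideas (planner-cruxidea-stmt-AtomisticToContinuum-15383-1-0, round 1):

* idea `unitarity-ceiling-far-field`: `Unitarity.abs_integral_mul_comp_le`, `Unitarity.abs_cov_comp_le_var`
  (|Cov(f, f∘T)| ≤ Var f for measure-preserving T), `Block.min_sq_int` (triangle decomposition of min(z²,R²)),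
  `Block.truncatedCeiling_of_block`, `Block.ceiling_of_block_of_farPositive` (block ceiling + conservation +
  continuity + far positive excess ⇒ the crux's anchored linear envelope).
* idea `subadditive-spike-collapse`: `Spike.le_eight_mul_average_of_sqrt_subadditive` (no-spike lemma),
  `Spike.ceiling_of_abel_of_subadditive` (Abel ceiling + subadditive √ ⇒ anchored linear envelope).

`lean check`: rc 0, 0 sorry; axioms of the main theorems: propext, Classical.choice, Quot.sound.
-/

/- ===== from planner file UnitarityCore.lean ===== -/
/-!
# Core of the unitarity ceiling (card `unitarity-ceiling-far-field`, crux stmt-AtomisticToContinuum-15383)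

For a measure-preserving map `T` and a real `f` with `f² ∈ L¹(μ)`:  `|∫ f · (f ∘ T) dμ| ≤ ∫ f² dμ`.
(Pointwise `2|ab| ≤ a² + b²` + invariance `∫ (f∘T)² = ∫ f²`; no Hilbert-space API needed.)
Applied to `f = A_Λ - ⟨A_Λ⟩`, `A_Λ = Σ_{x∈Λ} cos(kx) h_x` (and the `sin` companion), `T = φ_t`, this is the
finite-volume inequality `|Cov(A_Λ, A_Λ∘φ_t)| ≤ Var(A_Λ)` behind `UnitarityCeiling`.
-/

open MeasureTheory

namespace Summit.AtomisticToContinuum.FouriersLaw.Cruxes.LinearCeiling.Unitarity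

variable {α : Type*} [MeasurableSpace α]

theorem abs_integral_mul_comp_le (μ : Measure α) {T : α → α} (hT : MeasurePreserving T μ μ)
    {f : α → ℝ} (hf : AEStronglyMeasurable f μ) (hf2 : Integrable (fun x => f x ^ 2) μ) :
    |∫ x, f x * f (T x) ∂μ| ≤ ∫ x, f x ^ 2 ∂μ := by
  -- `(f ∘ T)²` is integrable with the same integral
  have hmeasT : AEStronglyMeasurable (fun x => f (T x)) μ := hf.comp_measurePreserving hT
  have hint2T : Integrable (fun x => f (T x) ^ 2) μ :=
    (hT.integrable_comp hf2.aestronglyMeasurable).mpr hf2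
  have heq : ∫ x, f (T x) ^ 2 ∂μ = ∫ x, f x ^ 2 ∂μ := by
    have h := integral_map (μ := μ) hT.measurable.aemeasurable
      (f := fun y => f y ^ 2) (by rw [hT.map_eq]; exact hf2.aestronglyMeasurable)
    rw [hT.map_eq] at h
    exact h.symm
  -- domination `|f · (f∘T)| ≤ (f² + (f∘T)²)/2`
  have hdom : ∀ x, |f x * f (T x)| ≤ (f x ^ 2 + f (T x) ^ 2) / 2 := by
    intro x
    rw [abs_le]
    constructor <;> nlinarith [sq_nonneg (f x - f (T x)), sq_nonneg (f x + f (T x))]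
  have hintg : Integrable (fun x => (f x ^ 2 + f (T x) ^ 2) / 2) μ := (hf2.add hint2T).div_const 2
  have hprod : Integrable (fun x => f x * f (T x)) μ :=
    hintg.mono' (hf.mul hmeasT) (Filter.Eventually.of_forall fun x => by
      simpa only [Real.norm_eq_abs] using hdom x)
  calc |∫ x, f x * f (T x) ∂μ| ≤ ∫ x, |f x * f (T x)| ∂μ := by
        simpa only [Real.norm_eq_abs] using norm_integral_le_integral_norm (fun x => f x * f (T x))
    _ ≤ ∫ x, (f x ^ 2 + f (T x) ^ 2) / 2 ∂μ :=
        integral_mono hprod.abs hintg hdom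
    _ = ((∫ x, f x ^ 2 ∂μ) + ∫ x, f (T x) ^ 2 ∂μ) / 2 := by
        rw [integral_div, integral_add hf2 hint2T]
    _ = ∫ x, f x ^ 2 ∂μ := by rw [heq]; ring

/-- Covariance form: for `μ`-preserving `T` and `f` with `f, f² ∈ L¹`, the lagged covariance is bounded by
the variance: `|∫ (f - m)((f - m) ∘ T)| ≤ ∫ (f - m)²` with `m = ∫ f`. -/
theorem abs_cov_comp_le_var (μ : Measure α) [IsProbabilityMeasure μ] {T : α → α}
    (hT : MeasurePreserving T μ μ) {f : α → ℝ} (hf : Integrable f μ)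
    (hf2 : Integrable (fun x => f x ^ 2) μ) :
    |∫ x, (f x - ∫ y, f y ∂μ) * (f (T x) - ∫ y, f y ∂μ) ∂μ| ≤ ∫ x, (f x - ∫ y, f y ∂μ) ^ 2 ∂μ := by
  set m : ℝ := ∫ y, f y ∂μ
  have hg : AEStronglyMeasurable (fun x => f x - m) μ := (hf.sub (integrable_const m)).aestronglyMeasurable
  have hg2 : Integrable (fun x => (f x - m) ^ 2) μ := by
    have : (fun x => (f x - m) ^ 2) = fun x => f x ^ 2 + ((-2 * m) * f x + m ^ 2) := by
      funext x; ring
    rw [this]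
    exact hf2.add ((hf.const_mul _).add (integrable_const _))
  exact abs_integral_mul_comp_le μ hT hg hg2

end Summit.AtomisticToContinuum.FouriersLaw.Cruxes.LinearCeiling.Unitarity

/- ===== from planner file BlockCeiling.lean ===== -/
/-!
# Truncated ceiling from the block form (card `unitarity-ceiling-far-field`, crux stmt-AtomisticToContinuum-15383)

Triangle decomposition `min(z², R²) = R² − (2R+1)(R−|z|)₊ + 2 Σ_{m=1}^{R} (m−|z|)₊` and the block
ceiling `|Σ_z (m−|z|)₊ S(z,t)| ≤ Σ_z (m−|z|)₊ S(z,0)` (+ conservation) give, for all `t`, `R`,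
`Σ_x min(x², R²) S(x,t) ≤ R² Σ_x S(x,0) + (3R²+2R) Σ_x |S(x,0)|`.
-/

open Finset

namespace Summit.AtomisticToContinuum.FouriersLaw.Cruxes.LinearCeiling.Block

/-- Triangle weight `T m z = (m - |z|)₊`. -/
noncomputable def tri (m : ℕ) (z : ℤ) : ℝ := max ((m : ℝ) - |(z : ℝ)|) 0

theorem tri_nonneg (m : ℕ) (z : ℤ) : 0 ≤ tri m z := le_max_right _ _

theorem tri_le (m : ℕ) (z : ℤ) : tri m z ≤ m := by
  unfold tri
  exact max_le (by linarith [abs_nonneg (z : ℝ)]) (Nat.cast_nonneg m)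

theorem abs_tri_le (m : ℕ) (z : ℤ) : |tri m z| ≤ m := by
  rw [abs_of_nonneg (tri_nonneg m z)]; exact tri_le m z

/-- The triangle decomposition of the capped parabola, for a natural argument. -/
theorem min_sq_nat (n : ℕ) : ∀ R : ℕ,
    min ((n : ℝ) ^ 2) ((R : ℝ) ^ 2) =
      (R : ℝ) ^ 2 - (2 * R + 1) * max ((R : ℝ) - n) 0 +
        2 * ∑ m ∈ range R, max ((m : ℝ) + 1 - n) 0 := by
  intro R
  induction R with
  | zero =>
    have h0 : max ((0 : ℝ) - n) 0 = 0 := max_eq_right (by simp)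
    simp only [Nat.cast_zero, sum_range_zero, mul_zero, add_zero]
    rw [h0]
    have : min ((n : ℝ) ^ 2) 0 = 0 := min_eq_right (by positivity)
    simp
  | succ R ih =>
    rw [sum_range_succ]
    push_cast
    rcases Nat.lt_or_ge R n with h | h
    · -- n ≥ R + 1: all triangles vanish
      have h1 : (R : ℝ) + 1 ≤ n := by exact_mod_cast h
      have e1 : max ((R : ℝ) - n) 0 = 0 := max_eq_right (by linarith)
      have e2 : max ((R : ℝ) + 1 - n) 0 = 0 := max_eq_right (by linarith)
      have e3 : min ((n : ℝ) ^ 2) ((R : ℝ) ^ 2) = (R : ℝ) ^ 2 := min_eq_right (by nlinarith)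
      have e4 : min ((n : ℝ) ^ 2) (((R : ℝ) + 1) ^ 2) = ((R : ℝ) + 1) ^ 2 := min_eq_right (by nlinarith)
      rw [e1, e3] at ih
      rw [e2, e4]
      have e5 : max ((R : ℝ) + 1 - n) 0 = 0 := e2
      rw [show ((R : ℝ) + 1 - (n : ℝ)) = (R : ℝ) + 1 - n from rfl] at e5
      nlinarith [ih]
    · -- n ≤ R
      have h1 : (n : ℝ) ≤ R := by exact_mod_cast h
      have e1 : max ((R : ℝ) - n) 0 = (R : ℝ) - n := max_eq_left (by linarith)
      have e2 : max ((R : ℝ) + 1 - n) 0 = (R : ℝ) + 1 - n := max_eq_left (by linarith)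
      have e3 : min ((n : ℝ) ^ 2) ((R : ℝ) ^ 2) = (n : ℝ) ^ 2 :=
        min_eq_left (pow_le_pow_left₀ (Nat.cast_nonneg n) h1 2)
      have e4 : min ((n : ℝ) ^ 2) (((R : ℝ) + 1) ^ 2) = (n : ℝ) ^ 2 :=
        min_eq_left (pow_le_pow_left₀ (Nat.cast_nonneg n) (by linarith) 2)
      rw [e1, e3] at ih
      rw [e2, e4]
      nlinarith [ih]

/-- The triangle decomposition on `ℤ`: `min(z², R²) = R² − (2R+1) tri R z + 2 Σ_{m<R} tri (m+1) z`. -/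
theorem min_sq_int (z : ℤ) (R : ℕ) :
    min ((z : ℝ) ^ 2) ((R : ℝ) ^ 2) =
      (R : ℝ) ^ 2 - (2 * R + 1) * tri R z + 2 * ∑ m ∈ range R, tri (m + 1) z := by
  have habs : |(z : ℝ)| = (z.natAbs : ℝ) := by
    rw [← Int.cast_abs, ← Int.natCast_natAbs, Int.cast_natCast]
  have hsq : (z : ℝ) ^ 2 = (z.natAbs : ℝ) ^ 2 := by rw [← habs, sq_abs]
  unfold tri
  rw [hsq, habs]
  have h := min_sq_nat z.natAbs R
  simpa [Nat.cast_add, Nat.cast_one, add_sub_assoc] using h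

theorem gauss_real (R : ℕ) : ∑ m ∈ range R, ((m : ℝ) + 1) = (R : ℝ) * (R + 1) / 2 := by
  induction R with
  | zero => simp
  | succ R ih => rw [sum_range_succ, ih]; push_cast; ring

/-- **Truncated ceiling from the block form.** -/
theorem truncatedCeiling_of_block (S : ℤ → ℝ → ℝ) (t : ℝ) (R : ℕ)
    (hsum : ∀ t : ℝ, Summable (fun x : ℤ => (1 + (x : ℝ) ^ 2) * |S x t|))
    (hcons : ∑' x : ℤ, S x t = ∑' x : ℤ, S x 0)
    (hblock : ∀ m : ℕ, |∑' z : ℤ, max ((m : ℝ) - |(z : ℝ)|) 0 * S z t| ≤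
      ∑' z : ℤ, max ((m : ℝ) - |(z : ℝ)|) 0 * S z 0) :
    ∑' x : ℤ, min ((x : ℝ) ^ 2) ((R : ℝ) ^ 2) * S x t ≤
      (R : ℝ) ^ 2 * (∑' x : ℤ, S x 0) + (3 * (R : ℝ) ^ 2 + 2 * R) * ∑' x : ℤ, |S x 0| := by
  -- summability bookkeeping
  have habs : ∀ s : ℝ, Summable (fun x : ℤ => |S x s|) := fun s =>
    Summable.of_nonneg_of_le (fun x => abs_nonneg _)
      (fun x => by nlinarith [abs_nonneg (S x s), sq_nonneg (x : ℝ)]) (hsum s)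
  have hS : ∀ s : ℝ, Summable (fun x : ℤ => S x s) := fun s => (habs s).of_abs
  have hT : ∀ (m : ℕ) (s : ℝ), Summable (fun x : ℤ => tri m x * S x s) := by
    intro m s
    refine Summable.of_norm_bounded (g := fun x : ℤ => (m : ℝ) * |S x s|) ((habs s).mul_left (m : ℝ)) ?_
    intro x
    rw [Real.norm_eq_abs, abs_mul]
    exact mul_le_mul_of_nonneg_right (abs_tri_le m x) (abs_nonneg _)
  -- block bound: Σ tri m · S(·,t) ≥ -m Σ|S(·,0)|
  have hB : ∀ m : ℕ, -((m : ℝ) * ∑' x : ℤ, |S x 0|) ≤ ∑' x : ℤ, tri m x * S x t := by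
    intro m
    have h1 : |∑' z : ℤ, tri m z * S z t| ≤ ∑' z : ℤ, tri m z * S z 0 := hblock m
    have h2 : ∑' z : ℤ, tri m z * S z 0 ≤ ∑' z : ℤ, (m : ℝ) * |S z 0| :=
      Summable.tsum_le_tsum (fun z => by
        calc tri m z * S z 0 ≤ |tri m z * S z 0| := le_abs_self _
          _ = |tri m z| * |S z 0| := abs_mul _ _
          _ ≤ m * |S z 0| := mul_le_mul_of_nonneg_right (abs_tri_le m z) (abs_nonneg _))
        (hT m 0) ((habs 0).mul_left (m : ℝ))
    rw [tsum_mul_left] at h2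
    have h3 := neg_abs_le (∑' z : ℤ, tri m z * S z t)
    linarith
  -- expand the capped parabola
  have hexp : ∀ x : ℤ, min ((x : ℝ) ^ 2) ((R : ℝ) ^ 2) * S x t =
      (R : ℝ) ^ 2 * S x t - (2 * R + 1) * (tri R x * S x t) +
        2 * ∑ m ∈ range R, tri (m + 1) x * S x t := by
    intro x
    rw [min_sq_int x R]
    have e : (2 * ∑ m ∈ range R, tri (m + 1) x) * S x t = 2 * ∑ m ∈ range R, tri (m + 1) x * S x t := by
      rw [mul_assoc, sum_mul]
    linear_combination e
  have hfin : Summable (fun x : ℤ => ∑ m ∈ range R, tri (m + 1) x * S x t) :=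
    summable_sum fun m _ => hT (m + 1) t
  have h1 : Summable (fun x : ℤ => (R : ℝ) ^ 2 * S x t - (2 * R + 1) * (tri R x * S x t)) :=
    ((hS t).mul_left _).sub ((hT R t).mul_left _)
  rw [tsum_congr hexp, Summable.tsum_add h1 (hfin.mul_left 2),
    Summable.tsum_sub ((hS t).mul_left _) ((hT R t).mul_left _), tsum_mul_left, tsum_mul_left,
    tsum_mul_left, Summable.tsum_finsetSum (fun m _ => hT (m + 1) t), hcons]
  -- bound the triangle terms
  have hsum2 : ∑ m ∈ range R, ∑' x : ℤ, tri (m + 1) x * S x t ≤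
      ∑ m ∈ range R, ((m : ℝ) + 1) * ∑' x : ℤ, |S x 0| := by
    refine sum_le_sum fun m _ => ?_
    have hb := hblock (m + 1)
    have h2 : ∑' z : ℤ, tri (m + 1) z * S z 0 ≤ ((m : ℝ) + 1) * ∑' z : ℤ, |S z 0| := by
      rw [← tsum_mul_left]
      refine Summable.tsum_le_tsum (fun z => ?_) (hT (m + 1) 0) ((habs 0).mul_left _)
      calc tri (m + 1) z * S z 0 ≤ |tri (m + 1) z * S z 0| := le_abs_self _
        _ = |tri (m + 1) z| * |S z 0| := abs_mul _ _
        _ ≤ ((m + 1 : ℕ) : ℝ) * |S z 0| := mul_le_mul_of_nonneg_right (abs_tri_le (m + 1) z) (abs_nonneg _)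
        _ = ((m : ℝ) + 1) * |S z 0| := by push_cast; ring
    have h3 : ∑' z : ℤ, tri (m + 1) z * S z t ≤ |∑' z : ℤ, tri (m + 1) z * S z t| := le_abs_self _
    have hb' : |∑' z : ℤ, tri (m + 1) z * S z t| ≤ ∑' z : ℤ, tri (m + 1) z * S z 0 := by
      simpa [tri] using hb
    linarith
  rw [← sum_mul, gauss_real] at hsum2
  have hBR := hB R
  have hR0 : (0 : ℝ) ≤ R := Nat.cast_nonneg R
  have hA0 : 0 ≤ ∑' x : ℤ, |S x 0| := tsum_nonneg fun x => abs_nonneg _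
  nlinarith [hBR, hsum2, hR0, hA0]


/-- `a = min a b + (a - b)₊`. -/
theorem min_add_max_sub (a b : ℝ) : min a b + max (a - b) 0 = a := by
  rcases le_total a b with h | h
  · rw [min_eq_left h, max_eq_right (by linarith)]; ring
  · rw [min_eq_right h, max_eq_left (by linarith)]; ring

/-- **Card A composition, block form (real analysis): block ceiling + conservation + far positive
excess + continuity of `M` ⇒ the crux's anchored linear envelope.** With `R = ⌈c√t⌉₊`:
`M(t) = Σ min(x²,R²) S + Σ (x²−R²)₊ S ≤ [R² χ + (3R²+2R) χ*] + Σ (x²−c²t)₊ S⁺ ≤ A + K t`. -/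
theorem ceiling_of_block_of_farPositive (S : ℤ → ℝ → ℝ) (b c t₀ : ℝ) (hc : 0 < c)
    (hsum : ∀ t : ℝ, Summable (fun x : ℤ => (1 + (x : ℝ) ^ 2) * |S x t|))
    (hcons : ∀ t : ℝ, ∑' x : ℤ, S x t = ∑' x : ℤ, S x 0)
    (hblock : ∀ (m : ℕ) (t : ℝ), |∑' z : ℤ, max ((m : ℝ) - |(z : ℝ)|) 0 * S z t| ≤
      ∑' z : ℤ, max ((m : ℝ) - |(z : ℝ)|) 0 * S z 0)
    (hM : Continuous fun t : ℝ => ∑' x : ℤ, (x : ℝ) ^ 2 * S x t)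
    (hfar : ∀ t : ℝ, t₀ ≤ t →
      ∑' x : ℤ, max ((x : ℝ) ^ 2 - c ^ 2 * t) 0 * max (S x t) 0 ≤ b * t) :
    ∃ b' t₃ : ℝ, ∀ t : ℝ, t₃ ≤ t →
      ∑' x : ℤ, (x : ℝ) ^ 2 * S x t ≤ (∑' x : ℤ, (x : ℝ) ^ 2 * S x t₃) + b' * (t - t₃) := by
  set χ : ℝ := ∑' x : ℤ, S x 0 with hχ
  set χs : ℝ := ∑' x : ℤ, |S x 0| with hχs
  have hχs0 : 0 ≤ χs := tsum_nonneg fun x => abs_nonneg _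
  -- pointwise summability helpers
  have hx2 : ∀ t : ℝ, Summable (fun x : ℤ => (x : ℝ) ^ 2 * |S x t|) := fun t =>
    Summable.of_nonneg_of_le (fun x => by positivity)
      (fun x => by nlinarith [abs_nonneg (S x t)]) (hsum t)
  -- Step 1: linear bound for t ≥ T₁
  set K : ℝ := 2 * c ^ 2 * |χ| + 6 * c ^ 2 * χs + 2 * c * χs + b with hK
  set A : ℝ := 2 * |χ| + 8 * χs with hA
  set T₁ : ℝ := max t₀ 1 with hT₁
  have hlin : ∀ t : ℝ, T₁ ≤ t → ∑' x : ℤ, (x : ℝ) ^ 2 * S x t ≤ K * t + A := by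
    intro t ht
    have ht1 : 1 ≤ t := (le_max_right _ _).trans ht
    have ht0 : 0 ≤ t := by linarith
    have htt₀ : t₀ ≤ t := (le_max_left _ _).trans ht
    set R : ℕ := ⌈c * Real.sqrt t⌉₊ with hR
    have hcs : 0 ≤ c * Real.sqrt t := by positivity
    have hR1 : c * Real.sqrt t ≤ R := Nat.le_ceil _
    have hR2 : (R : ℝ) ≤ c * Real.sqrt t + 1 := (Nat.ceil_lt_add_one hcs).le
    have hsqt : Real.sqrt t ^ 2 = t := Real.sq_sqrt ht0
    have hsqle : Real.sqrt t ≤ t := by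
      rw [Real.sqrt_le_left (by linarith)] <;> nlinarith
    have hRsq : c ^ 2 * t ≤ (R : ℝ) ^ 2 := by
      calc c ^ 2 * t = (c * Real.sqrt t) ^ 2 := by rw [mul_pow, hsqt]
        _ ≤ (R : ℝ) ^ 2 := pow_le_pow_left₀ hcs hR1 2
    -- split M(t)
    have hs1 : Summable (fun x : ℤ => min ((x : ℝ) ^ 2) ((R : ℝ) ^ 2) * S x t) :=
      Summable.of_norm_bounded (hx2 t) fun x => by
        rw [Real.norm_eq_abs, abs_mul]
        refine mul_le_mul_of_nonneg_right ?_ (abs_nonneg _)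
        rw [abs_of_nonneg (le_min (sq_nonneg _) (sq_nonneg _))]
        exact min_le_left _ _
    have hs2 : Summable (fun x : ℤ => max ((x : ℝ) ^ 2 - (R : ℝ) ^ 2) 0 * S x t) :=
      Summable.of_norm_bounded (hx2 t) fun x => by
        rw [Real.norm_eq_abs, abs_mul]
        refine mul_le_mul_of_nonneg_right ?_ (abs_nonneg _)
        rw [abs_of_nonneg (le_max_right _ _)]
        exact max_le (by nlinarith [sq_nonneg (R : ℝ)]) (sq_nonneg _)
    have hsplit : ∑' x : ℤ, (x : ℝ) ^ 2 * S x t =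
        (∑' x : ℤ, min ((x : ℝ) ^ 2) ((R : ℝ) ^ 2) * S x t) +
          ∑' x : ℤ, max ((x : ℝ) ^ 2 - (R : ℝ) ^ 2) 0 * S x t := by
      rw [← Summable.tsum_add hs1 hs2]
      exact tsum_congr fun x => by rw [← add_mul, min_add_max_sub]
    -- near part
    have hnear := truncatedCeiling_of_block S t R hsum (hcons t) (fun m => hblock m t)
    -- far part
    have hs3 : Summable (fun x : ℤ => max ((x : ℝ) ^ 2 - c ^ 2 * t) 0 * max (S x t) 0) :=
      Summable.of_norm_bounded (hx2 t) fun x => by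
        rw [Real.norm_eq_abs, abs_mul, abs_of_nonneg (le_max_right _ _),
          abs_of_nonneg (le_max_right _ _)]
        refine mul_le_mul (max_le (by nlinarith [sq_nonneg c]) (sq_nonneg _)) ?_ (le_max_right _ _)
          (sq_nonneg _)
        exact max_le (le_abs_self _) (abs_nonneg _)
    have hfarle : ∑' x : ℤ, max ((x : ℝ) ^ 2 - (R : ℝ) ^ 2) 0 * S x t ≤
        ∑' x : ℤ, max ((x : ℝ) ^ 2 - c ^ 2 * t) 0 * max (S x t) 0 := by
      refine Summable.tsum_le_tsum (fun x => ?_) hs2 hs3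
      have h1 : max ((x : ℝ) ^ 2 - (R : ℝ) ^ 2) 0 ≤ max ((x : ℝ) ^ 2 - c ^ 2 * t) 0 :=
        max_le_max (by linarith) le_rfl
      have h2 : S x t ≤ max (S x t) 0 := le_max_left _ _
      have h3 : 0 ≤ max ((x : ℝ) ^ 2 - (R : ℝ) ^ 2) 0 := le_max_right _ _
      have h4 : 0 ≤ max (S x t) 0 := le_max_right _ _
      calc max ((x : ℝ) ^ 2 - (R : ℝ) ^ 2) 0 * S x t ≤ max ((x : ℝ) ^ 2 - (R : ℝ) ^ 2) 0 * max (S x t) 0 :=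
            mul_le_mul_of_nonneg_left h2 h3
        _ ≤ max ((x : ℝ) ^ 2 - c ^ 2 * t) 0 * max (S x t) 0 := mul_le_mul_of_nonneg_right h1 h4
    have hfar' := hfar t htt₀
    -- assemble
    rw [hsplit]
    have hRle : (R : ℝ) ≤ c * t + 1 := by nlinarith
    have hRsq2 : (R : ℝ) ^ 2 ≤ 2 * c ^ 2 * t + 2 := by
      have : (R : ℝ) ^ 2 ≤ (c * Real.sqrt t + 1) ^ 2 := pow_le_pow_left₀ (Nat.cast_nonneg R) hR2 2
      nlinarith [hsqt, sq_nonneg (c * Real.sqrt t - 1)]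
    have hχle : (R : ℝ) ^ 2 * χ ≤ (2 * c ^ 2 * t + 2) * |χ| := by
      calc (R : ℝ) ^ 2 * χ ≤ (R : ℝ) ^ 2 * |χ| := mul_le_mul_of_nonneg_left (le_abs_self χ) (sq_nonneg _)
        _ ≤ (2 * c ^ 2 * t + 2) * |χ| := mul_le_mul_of_nonneg_right hRsq2 (abs_nonneg χ)
    have hR0 : (0 : ℝ) ≤ R := Nat.cast_nonneg R
    nlinarith [hnear, hfarle, hfar', hχle, hRsq2, hRle, hχs0, mul_nonneg hχs0 hR0, abs_nonneg χ,
      mul_nonneg (sq_nonneg c) hχs0, mul_nonneg hc.le hχs0]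
  -- Step 2: anchoring by continuity (as in the no-spike collapse)
  set L : ℝ := |K| + |A| + 1 with hL
  set g : ℝ → ℝ := fun t => (∑' x : ℤ, (x : ℝ) ^ 2 * S x t) - L * t with hg
  have hgcont : Continuous g := hM.sub (continuous_const.mul continuous_id)
  have hgle : ∀ t, T₁ ≤ t → g t ≤ -t := by
    intro t ht
    have ht1 : 1 ≤ t := (le_max_right _ _).trans ht
    have h1 := hlin t ht
    have h2 : K * t ≤ |K| * t := mul_le_mul_of_nonneg_right (le_abs_self K) (by linarith)
    have h3 : A ≤ |A| * t := by nlinarith [le_abs_self A, abs_nonneg A]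
    show (∑' x : ℤ, (x : ℝ) ^ 2 * S x t) - L * t ≤ -t
    rw [hL]; nlinarith
  set T₂ : ℝ := max T₁ (-(g T₁)) with hT₂
  obtain ⟨t₃, ht₃mem, ht₃max⟩ := (isCompact_Icc (a := T₁) (b := T₂)).exists_isMaxOn
    (Set.nonempty_Icc.2 (le_max_left _ _)) hgcont.continuousOn
  refine ⟨L, t₃, fun t ht => ?_⟩
  have hgt : g t ≤ g t₃ := by
    rcases le_or_gt t T₂ with h | h
    · exact isMaxOn_iff.mp ht₃max t ⟨ht₃mem.1.trans ht, h⟩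
    · have h1 : g t ≤ -t := hgle t (ht₃mem.1.trans ht)
      have h2 : g T₁ ≤ g t₃ := isMaxOn_iff.mp ht₃max T₁ ⟨le_rfl, le_max_left _ _⟩
      have h3 : -(g T₁) ≤ T₂ := le_max_right _ _
      linarith
  have e1 : g t = (∑' x : ℤ, (x : ℝ) ^ 2 * S x t) - L * t := rfl
  have e2 : g t₃ = (∑' x : ℤ, (x : ℝ) ^ 2 * S x t₃) - L * t₃ := rfl
  linarith [hgt, e1, e2]

end Summit.AtomisticToContinuum.FouriersLaw.Cruxes.LinearCeiling.Block

/- ===== from planner file SpikeLemma.lean ===== -/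
/-!
# No-spike lemma (card C, crux-ideate stmt-AtomisticToContinuum-15383)

A nonnegative measurable `f` on `[0,∞)` with subadditive square root cannot exceed eight times its
running average: `f t ≤ (8/t) ∫₀ᵗ f`. Covering argument: for `s ∈ [0,t]`,
`√f t ≤ √f s + √f (t-s)`, so one of `√f s`, `√f (t-s)` is `≥ √f t / 2`; the set where
`√f ≥ √f t / 2` and its reflection cover `[0,t]`, hence it has measure `≥ t/2`, and on it `f ≥ f t / 4`.
-/

open MeasureTheory Set

namespace Summit.AtomisticToContinuum.FouriersLaw.Cruxes.LinearCeiling.Spike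

theorem le_eight_mul_average_of_sqrt_subadditive (f : ℝ → ℝ) (hmeas : Measurable f)
    (hpos : ∀ t : ℝ, 0 ≤ t → 0 ≤ f t)
    (hsub : ∀ t s : ℝ, 0 ≤ t → 0 ≤ s → Real.sqrt (f (t + s)) ≤ Real.sqrt (f t) + Real.sqrt (f s))
    (hloc : ∀ t : ℝ, 0 < t → IntegrableOn f (Set.Icc 0 t)) :
    ∀ t : ℝ, 0 < t → f t ≤ 8 / t * ∫ s in Set.Icc (0:ℝ) t, f s := by
  intro t ht
  set a : ℝ := Real.sqrt (f t) / 2 with ha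
  have ha0 : 0 ≤ a := by positivity
  have hasq : a ^ 2 = f t / 4 := by
    rw [ha, div_pow, Real.sq_sqrt (hpos t ht.le)]; norm_num
  set E : Set ℝ := {s | s ∈ Set.Icc (0:ℝ) t ∧ a ≤ Real.sqrt (f s)} with hE
  have hEmeas : MeasurableSet E := by
    have h1 : MeasurableSet {s : ℝ | a ≤ Real.sqrt (f s)} :=
      measurableSet_le measurable_const hmeas.sqrt
    exact measurableSet_Icc.inter h1
  have hEsub : E ⊆ Set.Icc 0 t := fun s hs => hs.1
  -- covering
  have hcover : Set.Icc (0:ℝ) t ⊆ E ∪ ((fun s => t - s) ⁻¹' E) := by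
    intro s hs
    by_cases h : a ≤ Real.sqrt (f s)
    · exact Or.inl ⟨hs, h⟩
    · right
      refine ⟨⟨by linarith [hs.2], by linarith [hs.1]⟩, ?_⟩
      have h2 := hsub s (t - s) hs.1 (by linarith [hs.2])
      rw [add_sub_cancel] at h2
      push Not at h
      show a ≤ Real.sqrt (f (t - s))
      linarith
  -- reflection preserves volume
  have hrefl : volume ((fun s : ℝ => t - s) ⁻¹' E) = volume E :=
    (Measure.measurePreserving_sub_left volume t).measure_preimage hEmeas.nullMeasurableSet
  have hvolE : ENNReal.ofReal t ≤ 2 * volume E := by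
    calc ENNReal.ofReal t = volume (Set.Icc (0:ℝ) t) := by rw [Real.volume_Icc, sub_zero]
      _ ≤ volume (E ∪ ((fun s => t - s) ⁻¹' E)) := measure_mono hcover
      _ ≤ volume E + volume ((fun s => t - s) ⁻¹' E) := measure_union_le _ _
      _ = 2 * volume E := by rw [hrefl, two_mul]
  have hvolE_lt : volume E < ⊤ :=
    (measure_mono hEsub).trans_lt (by rw [Real.volume_Icc]; exact ENNReal.ofReal_lt_top)
  have hvolE_real : t / 2 ≤ (volume E).toReal := by
    have h2 : ENNReal.ofReal t ≤ 2 * volume E := hvolE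
    have h3 : (ENNReal.ofReal t).toReal ≤ (2 * volume E).toReal :=
      ENNReal.toReal_mono (ENNReal.mul_ne_top ENNReal.ofNat_ne_top hvolE_lt.ne) h2
    rw [ENNReal.toReal_ofReal ht.le, ENNReal.toReal_mul] at h3
    norm_num at h3
    linarith
  -- integral bounds
  have hfi : IntegrableOn f (Set.Icc 0 t) := hloc t ht
  have hfiE : IntegrableOn f E := hfi.mono_set hEsub
  have hnn : 0 ≤ᵐ[volume.restrict (Set.Icc (0:ℝ) t)] f := by
    filter_upwards [ae_restrict_mem measurableSet_Icc] with s hs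
    exact hpos s hs.1
  have hint1 : ∫ s in E, f s ≤ ∫ s in Set.Icc (0:ℝ) t, f s :=
    setIntegral_mono_set hfi hnn (ae_of_all _ hEsub)
  have hint2 : ∫ _ in E, a ^ 2 ≤ ∫ s in E, f s := by
    refine setIntegral_mono_on (integrableOn_const hvolE_lt.ne) hfiE hEmeas ?_
    intro s hs
    have h1 : a ≤ Real.sqrt (f s) := hs.2
    have h2 : 0 ≤ f s := hpos s hs.1.1
    calc a ^ 2 ≤ Real.sqrt (f s) ^ 2 := pow_le_pow_left₀ ha0 h1 2
      _ = f s := Real.sq_sqrt h2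
  have hint3 : ∫ _ in E, a ^ 2 = a ^ 2 * (volume E).toReal := by
    rw [setIntegral_const, smul_eq_mul, mul_comm, measureReal_def]
  -- assemble: f t * t / 8 ≤ a² (vol E) ≤ ∫ f
  have key : f t / 4 * (t / 2) ≤ ∫ s in Set.Icc (0:ℝ) t, f s := by
    calc f t / 4 * (t / 2) ≤ a ^ 2 * (volume E).toReal := by
          rw [← hasq]; exact mul_le_mul_of_nonneg_left hvolE_real (by positivity)
      _ = ∫ _ in E, a ^ 2 := hint3.symm
      _ ≤ ∫ s in E, f s := hint2
      _ ≤ ∫ s in Set.Icc (0:ℝ) t, f s := hint1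
  rw [div_mul_eq_mul_div, le_div_iff₀ ht]
  nlinarith [key]


/-- **Abel ceiling ⇒ pointwise linear envelope** (composition of card `subadditive-spike-collapse`):
if `f ≥ 0` is continuous with subadditive square root, `e^{-νt} f` is integrable on `(0,∞)` and the
Abel means satisfy `ν² ∫₀^∞ e^{-νt} f ≤ 2B` for `0 < ν < ν₀`, then `f t ≤ 16 e B⁺ t` for
`t ≥ 1/ν₀ + 1` (no-spike lemma + `e^{-s/t} ≥ e^{-1}` on `[0,t]`), and by continuity `f` admits an
anchored linear upper envelope `f t ≤ f t₃ + b (t - t₃)` for `t ≥ t₃`. -/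
theorem ceiling_of_abel_of_subadditive (f : ℝ → ℝ) (B ν₀ : ℝ) (hν₀ : 0 < ν₀)
    (hcont : Continuous f) (hpos : ∀ t : ℝ, 0 ≤ t → 0 ≤ f t)
    (hsub : ∀ t s : ℝ, 0 ≤ t → 0 ≤ s → Real.sqrt (f (t + s)) ≤ Real.sqrt (f t) + Real.sqrt (f s))
    (hint : ∀ ν : ℝ, 0 < ν → IntegrableOn (fun t : ℝ => Real.exp (-(ν * t)) * f t) (Set.Ioi 0))
    (habel : ∀ ν : ℝ, 0 < ν → ν < ν₀ →
      ν ^ 2 * ∫ t in Set.Ioi (0:ℝ), Real.exp (-(ν * t)) * f t ≤ 2 * B) :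
    ∃ b t₃ : ℝ, ∀ t : ℝ, t₃ ≤ t → f t ≤ f t₃ + b * (t - t₃) := by
  -- the no-spike lemma applies
  have hspike := le_eight_mul_average_of_sqrt_subadditive f hcont.measurable hpos hsub
    (fun t _ => hcont.integrableOn_Icc)
  -- Step 1: `f t ≤ K t` for `t ≥ T₁`
  set K : ℝ := 16 * Real.exp 1 * max B 0 with hK
  set T₁ : ℝ := ν₀⁻¹ + 1 with hT₁
  have hT₁pos : 0 < T₁ := by positivity
  have hlin : ∀ t : ℝ, T₁ ≤ t → f t ≤ K * t := by
    intro t ht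
    have htpos : 0 < t := hT₁pos.trans_le ht
    have hν : 0 < t⁻¹ := inv_pos.2 htpos
    have hνlt : t⁻¹ < ν₀ := by
      rw [inv_lt_comm₀ htpos hν₀]
      linarith
    -- Abel bound at `ν = t⁻¹`
    have hA := habel t⁻¹ hν hνlt
    have hI : ∫ s in Set.Ioi (0:ℝ), Real.exp (-(t⁻¹ * s)) * f s ≤ 2 * max B 0 * t ^ 2 := by
      have h1 : t⁻¹ ^ 2 * ∫ s in Set.Ioi (0:ℝ), Real.exp (-(t⁻¹ * s)) * f s ≤ 2 * max B 0 :=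
        hA.trans (by nlinarith [le_max_left B 0])
      have h2 : t ^ 2 * (t⁻¹ ^ 2 * ∫ s in Set.Ioi (0:ℝ), Real.exp (-(t⁻¹ * s)) * f s) ≤
          t ^ 2 * (2 * max B 0) :=
        mul_le_mul_of_nonneg_left h1 (by positivity)
      have h3 : t ^ 2 * t⁻¹ ^ 2 = 1 := by field_simp
      calc ∫ s in Set.Ioi (0:ℝ), Real.exp (-(t⁻¹ * s)) * f s
          = t ^ 2 * t⁻¹ ^ 2 * ∫ s in Set.Ioi (0:ℝ), Real.exp (-(t⁻¹ * s)) * f s := by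
            rw [h3, one_mul]
        _ = t ^ 2 * (t⁻¹ ^ 2 * ∫ s in Set.Ioi (0:ℝ), Real.exp (-(t⁻¹ * s)) * f s) := by ring
        _ ≤ t ^ 2 * (2 * max B 0) := h2
        _ = 2 * max B 0 * t ^ 2 := by ring
    -- `∫_{[0,t]} f ≤ e · ∫_{(0,∞)} e^{-s/t} f`
    have hnn : ∀ s, s ∈ Set.Ioi (0:ℝ) → 0 ≤ Real.exp (-(t⁻¹ * s)) * f s :=
      fun s hs => mul_nonneg (Real.exp_pos _).le (hpos s (le_of_lt hs))
    have hIcc : ∫ s in Set.Icc (0:ℝ) t, f s ≤ Real.exp 1 * (2 * max B 0 * t ^ 2) := by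
      rw [integral_Icc_eq_integral_Ioc]
      have hfi : IntegrableOn f (Set.Ioc 0 t) :=
        (hcont.integrableOn_Icc).mono_set Set.Ioc_subset_Icc_self
      have hgi : IntegrableOn (fun s => Real.exp (-(t⁻¹ * s)) * f s) (Set.Ioc 0 t) :=
        (hint t⁻¹ hν).mono_set Set.Ioc_subset_Ioi_self
      have step1 : ∫ s in Set.Ioc (0:ℝ) t, f s ≤
          ∫ s in Set.Ioc (0:ℝ) t, Real.exp 1 * (Real.exp (-(t⁻¹ * s)) * f s) := by
        refine setIntegral_mono_on hfi (hgi.const_mul _) measurableSet_Ioc ?_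
        intro s hs
        have hs1 : t⁻¹ * s ≤ 1 := by
          rw [inv_mul_le_iff₀ htpos]; linarith [hs.2]
        have he : 1 ≤ Real.exp 1 * Real.exp (-(t⁻¹ * s)) := by
          rw [← Real.exp_add]; exact Real.one_le_exp (by linarith)
        have hf0 : 0 ≤ f s := hpos s hs.1.le
        nlinarith
      have step2 : ∫ s in Set.Ioc (0:ℝ) t, Real.exp 1 * (Real.exp (-(t⁻¹ * s)) * f s) =
          Real.exp 1 * ∫ s in Set.Ioc (0:ℝ) t, Real.exp (-(t⁻¹ * s)) * f s :=
        integral_const_mul _ _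
      have step3 : ∫ s in Set.Ioc (0:ℝ) t, Real.exp (-(t⁻¹ * s)) * f s ≤
          ∫ s in Set.Ioi (0:ℝ), Real.exp (-(t⁻¹ * s)) * f s :=
        setIntegral_mono_set (hint t⁻¹ hν)
          ((ae_restrict_iff' measurableSet_Ioi).2 (ae_of_all _ hnn))
          (ae_of_all _ Set.Ioc_subset_Ioi_self)
      calc ∫ s in Set.Ioc (0:ℝ) t, f s
          ≤ ∫ s in Set.Ioc (0:ℝ) t, Real.exp 1 * (Real.exp (-(t⁻¹ * s)) * f s) := step1
        _ = Real.exp 1 * ∫ s in Set.Ioc (0:ℝ) t, Real.exp (-(t⁻¹ * s)) * f s := step2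
        _ ≤ Real.exp 1 * ∫ s in Set.Ioi (0:ℝ), Real.exp (-(t⁻¹ * s)) * f s :=
            mul_le_mul_of_nonneg_left step3 (Real.exp_pos 1).le
        _ ≤ Real.exp 1 * (2 * max B 0 * t ^ 2) :=
            mul_le_mul_of_nonneg_left hI (Real.exp_pos 1).le
    calc f t ≤ 8 / t * ∫ s in Set.Icc (0:ℝ) t, f s := hspike t htpos
      _ ≤ 8 / t * (Real.exp 1 * (2 * max B 0 * t ^ 2)) :=
          mul_le_mul_of_nonneg_left hIcc (by positivity)
      _ = K * t := by rw [hK]; field_simp; ring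
  -- Step 2: anchoring by continuity
  set g : ℝ → ℝ := fun t => f t - (K + 1) * t with hg
  have hgcont : Continuous g := hcont.sub (continuous_const.mul continuous_id)
  have hgle : ∀ t, T₁ ≤ t → g t ≤ -t := by
    intro t ht
    have h1 := hlin t ht
    show f t - (K + 1) * t ≤ -t
    linarith
  set T₂ : ℝ := max T₁ (-(g T₁)) with hT₂
  obtain ⟨t₃, ht₃mem, ht₃max⟩ := (isCompact_Icc (a := T₁) (b := T₂)).exists_isMaxOn
    (Set.nonempty_Icc.2 (le_max_left _ _)) hgcont.continuousOn
  refine ⟨K + 1, t₃, fun t ht => ?_⟩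
  have hgt : g t ≤ g t₃ := by
    rcases le_or_gt t T₂ with h | h
    · exact isMaxOn_iff.mp ht₃max t ⟨ht₃mem.1.trans ht, h⟩
    · have h1 : g t ≤ -t := hgle t (ht₃mem.1.trans ht)
      have h2 : g T₁ ≤ g t₃ := isMaxOn_iff.mp ht₃max T₁ ⟨le_rfl, le_max_left _ _⟩
      have h3 : -(g T₁) ≤ T₂ := le_max_right _ _
      linarith
  have e1 : g t = f t - (K + 1) * t := rfl
  have e2 : g t₃ = f t₃ - (K + 1) * t₃ := rfl
  linarith [hgt, e1, e2]

end Summit.AtomisticToContinuum.FouriersLaw.Cruxes.LinearCeiling.Spike
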